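import Literature.RingTheory.Derivation.SliceDecomposition
import Mathlib.Algebra.Algebra.ZMod
import Mathlib.Algebra.Module.ZMod
import Mathlib.FieldTheory.Finite.Basic
import HarnessLib

/-!
# Crux `Steer` (stmt-ResolutionOfSingularities-16345), chain W4.1 — idea-2's dictionary DICT
# `SimpleIsLogFinal`, piece **2: SLICES AND WEIGHTS** — projection along a commuting `p`-nilpotent family
# with dual slices (`α_p^r`), and the eigen-decomposition of a derivation with `ε^[p] = ε` (`μ_p`)

OURS (campaign `res-hironaka`, rung L, slot W4.1, chain W4.1; seat res-D-pv-007 AS res-L0-w41-stub-5; replaces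
the role of no printed item; NOT a statement of the manuscript under review [claim: Hironaka2017, status:
under-review]; AI-produced, weaker than expert review). Theses-free, definition-free, pure commutative algebra
over the tree's `Literature.RingTheory.Derivation.SliceDecomposition` (Matsumura Ex. 25.5) and Mathlib.

## Results (namespace `…SwitchingDichotomy.LogFrame`)

* `exists_proj_of_commuting_slices` (**`α_p^r`-PROJECTION**). `A` of prime characteristic `p`; `D i`
  (`i ∈ s`, a finite set of indices) pairwise COMMUTING derivations with `D i ^[p] = 0` and DUAL slices
  `D i (x i') = δ_{ii'}`. Then every `a ∈ A` is congruent modulo the ideal `(x i : i ∈ s)` to a COMMON CONSTANT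
  `a₀` (`D i a₀ = 0` for `i ∈ s`); moreover a derivation commuting with the `D i`, killing the `x i` and killing
  `a` kills `a₀`. Proof: Matsumura's decomposition `a = ∑_{l<p} c_l x^l` one slice at a time; the constant term
  inherits the other constancies by UNIQUENESS of the decomposition.
* `exists_eigen_decomposition` (**`μ_p`-WEIGHTS**). `A` of prime characteristic `p`, `ε` a derivation with
  `ε^[p] = ε`. Then every `a` is a sum `∑_{λ ∈ 𝔽_p} a_λ` of EIGENVECTORS `ε a_λ = λ a_λ`, where each `a_λ` lies in
  every `ε`-stable additive subgroup containing `a` and is an eigenvector (same eigenvalue) of every additive map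
  commuting with `ε` for which `a` is an eigenvector with eigenvalue in the prime field. Proof: the projectors
  `1 - (ε - λ)^{p-1}` — the identity `∑_λ (1 - (T - λ)^{p-1}) = 1` in `𝔽_p[T]` (a polynomial of degree `< p`
  taking the value `1` at every point of `𝔽_p`, Fermat) evaluated at `ε` in `End_{𝔽_p}(A)`, and
  `(T - λ)((1 - (T - λ)^{p-1})) = T - T^p`.

Sources: H. Matsumura, *Commutative Ring Theory*, §25 Ex. 25.5; N. Jacobson, *Lectures in Abstract Algebra III*,
Ch. IV §8 (restricted Lie algebras of derivations; semisimple `D^p = D`) — folklore linear algebra of `μ_p`- and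
`α_p`-actions. [cite: Matsumura1987, §25 Exercise 25.5] [folklore]
-/

noncomputable section

-- `Summit.<S>.<S>.…` duplicates the summit name by design (single-problem summit).
set_option linter.dupNamespace false
set_option autoImplicit false

namespace Summit.ResolutionOfSingularities.ResolutionOfSingularities.Theorems.SwitchingDichotomy

namespace LogFrame

open Finset Polynomial
open scoped Nat
open Literature.RingTheory.Derivation

variable {A : Type*} [CommRing A]

/-! ## §1 Projection along commuting nilpotent derivations with dual slices -/

section Projection

variable (p : ℕ) [Fact p.Prime] [CharP A p] {ι : Type*} (D : ι → Derivation ℤ A A) (x : ι → A)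

/-- A derivation killing `x` kills the powers of `x`. [folklore] -/
theorem apply_pow_eq_zero_of_apply_eq_zero (θ : Derivation ℤ A A) {b : A} (hb : θ b = 0) (l : ℕ) :
    θ (b ^ l) = 0 := by
  rw [θ.leibniz_pow, hb, smul_zero, smul_zero]

/-- One slice: modulo `x` every element is congruent to a `D`-constant, and that constant is killed by
every derivation `θ` commuting with `D`, killing `x` and killing the element (uniqueness of Matsumura's
decomposition applied to `θ` of it). [cite: Matsumura1987, §25 Exercise 25.5] -/
theorem exists_proj_one_slice (δ : Derivation ℤ A A) {b : A} (hb : δ b = 1) (hδp : ∀ a, (⇑δ)^[p] a = 0)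
    (a : A) : ∃ a₀ : A, δ a₀ = 0 ∧ b ∣ a - a₀ ∧
      ∀ θ : Derivation ℤ A A, (∀ a', θ (δ a') = δ (θ a')) → θ b = 0 → θ a = 0 → θ a₀ = 0 := by
  have hunit : ∀ l, l < p → IsUnit ((l ! : ℕ) : A) := fun l hl => isUnit_cast_factorial_of_lt p hl
  obtain ⟨c, hc, hca⟩ := exists_sum_mul_pow_of_iterate_eq_zero δ hb p hunit a (hδp a)
  obtain ⟨r, hr⟩ : ∃ r, p = r + 1 := ⟨p - 1, (Nat.sub_add_cancel (Fact.out : p.Prime).one_le).symm⟩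
  refine ⟨c 0, hc 0, ?_, fun θ hθδ hθb hθa => ?_⟩
  · -- `a - c 0 = ∑_{l<r} c (l+1) b^(l+1)` is divisible by `b`
    rw [hca, hr, sum_range_succ', pow_zero, mul_one, add_sub_cancel_right]
    exact Finset.dvd_sum fun l _ => ⟨c (l + 1) * b ^ l, by ring⟩
  · -- `θ a = ∑ θ (c l) b^l = 0` with `δ (θ (c l)) = 0`: uniqueness gives `θ (c l) = 0`
    have hsum : ∑ l ∈ range p, θ (c l) * b ^ l = 0 := by
      rw [← hθa, hca, map_sum]
      exact Finset.sum_congr rfl fun l _ => by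
        rw [Derivation.leibniz, apply_pow_eq_zero_of_apply_eq_zero θ hθb, smul_zero, zero_add, smul_eq_mul,
          mul_comm]
    have hcθ : ∀ l, l < p → δ (θ (c l)) = 0 := fun l _ => by rw [← hθδ, hc l, map_zero]
    exact eq_zero_of_sum_mul_pow_eq_zero_of_isUnit δ hb p hunit (fun l => θ (c l)) hcθ hsum 0
      (Fact.out : p.Prime).pos

/-- **Projection along commuting nilpotent derivations with dual slices** (`α_p^r`-action): for a finite set
`s` of indices, pairwise commuting `D i` with `D i ^[p] = 0` and `D i (x i') = δ_{ii'}`, every `a` is congruent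
modulo `(x i : i ∈ s)` to an element killed by all `D i`, `i ∈ s`; a derivation commuting with the `D i`
(`i ∈ s`), killing the `x i` (`i ∈ s`) and killing `a` kills that element. [cite: Matsumura1987, §25 Exercise 25.5] -/
theorem exists_proj_of_commuting_slices [DecidableEq ι]
    (hdual : ∀ i i', D i (x i') = if i = i' then 1 else 0)
    (hcomm : ∀ i i' a, D i (D i' a) = D i' (D i a)) (hnil : ∀ i a, (⇑(D i))^[p] a = 0)
    (s : Finset ι) (a : A) :
    ∃ a₀ : A, (∀ i ∈ s, D i a₀ = 0) ∧ a - a₀ ∈ Ideal.span (x '' s) ∧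
      ∀ θ : Derivation ℤ A A, (∀ i ∈ s, ∀ a', θ (D i a') = D i (θ a')) → (∀ i ∈ s, θ (x i) = 0) →
        θ a = 0 → θ a₀ = 0 := by
  induction s using Finset.induction_on generalizing a with
  | empty =>
    exact ⟨a, fun i hi => absurd hi (Finset.notMem_empty i), by simp, fun θ _ _ h => h⟩
  | insert i s hi ih =>
    obtain ⟨a₁, ha₁, hmem₁, hθ₁⟩ := ih a
    obtain ⟨a₀, ha₀, hdvd, hθ₀⟩ :=
      exists_proj_one_slice p (D i) (by rw [hdual, if_pos rfl]) (hnil i) a₁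
    refine ⟨a₀, fun i' hi' => ?_, ?_, fun θ hθc hθx hθa => ?_⟩
    · rcases Finset.mem_insert.mp hi' with rfl | hi'
      · exact ha₀
      · -- `D i'` commutes with `D i`, kills `x i` (`i' ≠ i`) and kills `a₁`
        refine hθ₀ (D i') (fun a' => hcomm i' i a') ?_ (ha₁ i' hi')
        rw [hdual, if_neg (fun h : i' = i => hi (h ▸ hi'))]
    · have h1 : a - a₀ = (a - a₁) + (a₁ - a₀) := by ring
      rw [h1, Finset.coe_insert, Set.image_insert_eq]
      refine Ideal.add_mem _ (Ideal.span_mono (Set.subset_insert _ _) hmem₁) ?_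
      obtain ⟨r, hr⟩ := hdvd
      rw [hr]
      exact Ideal.mul_mem_right _ _ (Ideal.subset_span (Set.mem_insert _ _))
    · exact hθ₀ θ (hθc i (Finset.mem_insert_self i s)) (hθx i (Finset.mem_insert_self i s))
        (hθ₁ θ (fun i' hi' => hθc i' (Finset.mem_insert_of_mem hi'))
          (fun i' hi' => hθx i' (Finset.mem_insert_of_mem hi')) hθa)

end Projection

/-! ## §2 Weights: the eigen-decomposition of a derivation with `ε^[p] = ε` -/

section Torus

variable (p : ℕ) [Fact p.Prime]

/-- The Lagrange identity `∑_{λ ∈ 𝔽_p} (1 - (T - λ)^{p-1}) = 1` in `𝔽_p[T]`: both sides have degree `< p` and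
agree at every point of `𝔽_p` (Fermat: `(μ - λ)^{p-1} = 1` for `λ ≠ μ`). [folklore] -/
theorem sum_one_sub_X_sub_C_pow_eq_one :
    ∑ c : ZMod p, (1 - (X - C c) ^ (p - 1)) = (1 : (ZMod p)[X]) := by
  have hp : p.Prime := Fact.out
  refine eq_of_natDegree_lt_card_of_eval_eq _ _ (f := fun c : ZMod p => c) (fun _ _ h => h) ?_ ?_
  · intro μ
    rw [eval_one, eval_finsetSum]
    simp only [eval_sub, eval_one, eval_pow, eval_X, eval_C]
    rw [Finset.sum_eq_single μ]
    · rw [sub_self, zero_pow (Nat.sub_ne_zero_of_lt hp.one_lt), sub_zero]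
    · intro c _ hc
      rw [ZMod.pow_card_sub_one_eq_one (sub_ne_zero.mpr (Ne.symm hc)), sub_self]
    · intro h
      exact absurd (Finset.mem_univ μ) h
  · rw [natDegree_one, Nat.max_zero, ZMod.card]
    refine lt_of_le_of_lt (natDegree_sum_le_of_forall_le (n := p - 1) Finset.univ _ fun c _ => ?_)
      (Nat.sub_lt hp.pos one_pos)
    refine (natDegree_sub_le _ _).trans ?_
    rw [natDegree_one, Nat.zero_max]
    exact natDegree_pow_le.trans (by rw [natDegree_X_sub_C, mul_one])

/-- `(T - λ) · (1 - (T - λ)^{p-1}) = T - T^p` in `𝔽_p[T]` (`λ^p = λ`). [folklore] -/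
theorem X_sub_C_mul_one_sub_pow (c : ZMod p) :
    (X - C c) * (1 - (X - C c) ^ (p - 1)) = (X - X ^ p : (ZMod p)[X]) := by
  have hp : p.Prime := Fact.out
  have h1 : (X - C c) * (X - C c) ^ (p - 1) = (X - C c) ^ p := by
    rw [← pow_succ', Nat.sub_add_cancel hp.one_le]
  rw [mul_sub, mul_one, h1, sub_pow_char X (C c), ← C_pow, ZMod.pow_card]
  ring

variable [CharP A p]

/-- **Eigen-decomposition for `ε^[p] = ε`** (`μ_p`-action). `A` of prime characteristic `p`, `ε` a derivation
of `A` with `ε^[p] = ε`. Every `a ∈ A` is a sum `∑_{λ ∈ 𝔽_p} a_λ` with `ε a_λ = λ · a_λ`; each `a_λ` lies in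
every `ε`-stable additive subgroup containing `a`, and is an eigenvector with eigenvalue `μ` of every additive
map `θ` commuting with `ε` such that `θ a = μ · a` (`μ` in the prime field).
[cite: Matsumura1987, §25 (restricted Lie algebra of derivations)] [folklore] -/
theorem exists_eigen_decomposition (ε : Derivation ℤ A A) (hε : ∀ a, (⇑ε)^[p] a = ε a) (a : A) :
    ∃ e : ZMod p → A, (∑ c, e c = a) ∧ (∀ c, ε (e c) = (c.val : A) * e c) ∧
      (∀ P : AddSubgroup A, (∀ b ∈ P, ε b ∈ P) → a ∈ P → ∀ c, e c ∈ P) ∧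
      (∀ (θ : A →+ A) (μ : ℕ), (∀ b, θ (ε b) = ε (θ b)) → θ a = (μ : A) * a →
        ∀ c, θ (e c) = (μ : A) * e c) := by
  have hp : p.Prime := Fact.out
  -- `A` as an `𝔽_p`-vector space, `ε` as an `𝔽_p`-linear endomorphism
  letI inst : Algebra (ZMod p) A := ZMod.algebra A p
  have hsmul : ∀ (c : ZMod p) (b : A), c • b = (c.val : A) * b := fun c b => by
    rw [Algebra.smul_def]; change (ZMod.cast c : A) * b = _; rw [ZMod.cast_eq_val]
  obtain ⟨f, hf⟩ : ∃ f : A →ₗ[ZMod p] A, ∀ b, f b = ε b := ⟨(ε : A →+ A).toZModLinearMap p, fun _ => rfl⟩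
  have hfp : f ^ p = f := by
    ext b
    rw [Module.End.pow_apply, show (⇑f) = ⇑ε from funext hf, hε]
  -- the projectors `Q c := 1 - (X - C c)^(p-1)` evaluated at `f`
  let e : ZMod p → A := fun c => aeval f (1 - (X - C c) ^ (p - 1)) a
  have he : ∀ c, e c = aeval f (1 - (X - C c) ^ (p - 1)) a := fun c => rfl
  refine ⟨e, ?_, fun c => ?_, fun P hP haP c => ?_, fun θ μ hθε hθa c => ?_⟩
  · -- sum of the projectors is the identity
    have h := congrArg (fun Q : (ZMod p)[X] => aeval f Q a) (sum_one_sub_X_sub_C_pow_eq_one p)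
    simpa only [map_sum, LinearMap.coe_sum, Finset.sum_apply, map_one, Module.End.one_apply] using h
  · -- each projector lands in the eigenspace: `(f - c) (Q c (f) a) = (f - f^p) a = 0`
    have h0 : (aeval f (X - C c)) (e c) = 0 := by
      rw [he, ← Module.End.mul_apply, ← map_mul, X_sub_C_mul_one_sub_pow p c, map_sub, map_pow, aeval_X,
        hfp, sub_self, LinearMap.zero_apply]
    rw [map_sub, aeval_X, aeval_C, LinearMap.sub_apply, Module.algebraMap_end_apply, sub_eq_zero, hf,
      hsmul] at h0
    exact h0
  · -- membership in `ε`-stable additive subgroups: true for every polynomial in `f`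
    suffices h : ∀ Q : (ZMod p)[X], aeval f Q a ∈ P from h _
    intro Q
    induction Q using Polynomial.induction_on' with
    | add Q₁ Q₂ h₁ h₂ => rw [map_add, LinearMap.add_apply]; exact P.add_mem h₁ h₂
    | monomial k r =>
      rw [aeval_monomial, Module.End.mul_apply, Module.algebraMap_end_apply, Module.End.pow_apply]
      refine ZMod.smul_mem ?_ r
      induction k with
      | zero => exact haP
      | succ k ih => rw [Function.iterate_succ_apply', hf]; exact hP _ ih
  · -- eigenvectors of commuting additive maps: `θ (Q(f) a) = Q(f) (θ a) = Q(f) (μ • a) = μ • Q(f) a`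
    have hcomm : ∀ Q : (ZMod p)[X], ∀ b, θ (aeval f Q b) = aeval f Q (θ b) := by
      intro Q
      induction Q using Polynomial.induction_on' with
      | add Q₁ Q₂ h₁ h₂ => intro b; rw [map_add, LinearMap.add_apply, LinearMap.add_apply, map_add, h₁, h₂]
      | monomial k r =>
        intro b
        rw [aeval_monomial, Module.End.mul_apply, Module.End.mul_apply, Module.algebraMap_end_apply,
          Module.algebraMap_end_apply, Module.End.pow_apply, Module.End.pow_apply, ZMod.map_smul]
        congr 1
        induction k with
        | zero => rfl
        | succ k ih => rw [Function.iterate_succ_apply', Function.iterate_succ_apply', hf, hf, hθε, ih]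
    rw [he, hcomm, hθa, ← nsmul_eq_mul, map_nsmul, nsmul_eq_mul]

end Torus

end LogFrame

end Summit.ResolutionOfSingularities.ResolutionOfSingularities.Theorems.SwitchingDichotomy
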